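import Summits.Ventures.HodgeRepro2.T5HeckePolynomialAlgebra

/-!
# T5HeckeCharacterParameter — a character of `k[T₁]` is one number: the Satake parameter as the
# value of the Hecke eigencharacter at `T₁`

Tier-5 kernel support (seat p8, blind lane; sub-step N3).  T5-180 showed that an algebra with a
basis `T₀ = 1, T₁, T₂, …` and the leading-term property is `k[T₁]`.  Hence its `k`-algebra
characters `χ : A → C` are determined by, and freely prescribed by, the single value `χ(T₁)`:

* `algHom_ext_of_leading` — `χ(T₁) = χ'(T₁) ⇒ χ = χ'`;
* `exists_algHom_apply_eq` — every `c : C` is `χ(T₁)` for some `χ`;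
* `bijective_apply_one` — `χ ↦ χ(T₁)` is a bijection `(A →ₐ[k] C) ≃ C`;
* the instantiation on T5-136's cell basis of `H(U(J₃(u)), K_U)` (given the leading-term property
  `hlead`): the Hecke eigencharacter of a spherical vector is ONE parameter — the record's «the
  spherical vector is a simultaneous eigenvector with eigencharacter the Satake parameter»
  (CHECK-N3 §17 rows 5–6), with the parameter read as the `T₁`-eigenvalue
  (`heckeAlgebra_algHom_ext_of_leading`, `heckeAlgebra_exists_algHom_apply_eq`).

No `sorry`, no axiom beyond `propext`, `Classical.choice`, `Quot.sound`.
-/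

namespace Summit.Ventures.HodgeRepro2.T5HeckeCharacterParameter

open Polynomial Submodule

section Abstract

variable {k : Type*} [Field k] {B : Type*} [Ring B] [Algebra k B] {A : Subalgebra k B}
  (T : Module.Basis ℕ k A) {C : Type*} [Semiring C] [Algebra k C]

/-- Two characters agreeing at `T 1` agree everywhere. -/
theorem algHom_ext_of_leading (hT0 : T 0 = 1)
    (hlead : ∀ n, T 1 * T n - T (n + 1) ∈ span k (⇑T '' {i | i < n + 1}))
    {χ χ' : A →ₐ[k] C} (h : χ (T 1) = χ' (T 1)) : χ = χ' := by
  ext a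
  obtain ⟨p, rfl⟩ := T5HeckePolynomialAlgebra.aeval_surjective T hT0 hlead a
  rw [← AlgHom.comp_apply, ← AlgHom.comp_apply]
  congr 1
  apply Polynomial.algHom_ext
  simp [h]

/-- Every value is attained at `T 1` by some character. -/
theorem exists_algHom_apply_eq (hT0 : T 0 = 1)
    (hlead : ∀ n, T 1 * T n - T (n + 1) ∈ span k (⇑T '' {i | i < n + 1})) (c : C) :
    ∃ χ : A →ₐ[k] C, χ (T 1) = c := by
  let e := AlgEquiv.ofBijective _ (T5HeckePolynomialAlgebra.aeval_bijective T hT0 hlead)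
  refine ⟨(aeval c).comp e.symm.toAlgHom, ?_⟩
  have hX : e X = T 1 := aeval_X _
  rw [AlgHom.comp_apply, AlgEquiv.coe_toAlgHom, ← hX, e.symm_apply_apply, aeval_X]

/-- **`χ ↦ χ(T 1)` is a bijection from the characters of `A` onto `C`.** -/
theorem bijective_apply_one (hT0 : T 0 = 1)
    (hlead : ∀ n, T 1 * T n - T (n + 1) ∈ span k (⇑T '' {i | i < n + 1})) :
    Function.Bijective (fun χ : A →ₐ[k] C => χ (T 1)) :=
  ⟨fun _ _ h => algHom_ext_of_leading T hT0 hlead h, exists_algHom_apply_eq T hT0 hlead⟩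

end Abstract

section Hecke

variable {R : Type*} {E : Type*} [CommRing R] [Field E] [StarRing E] [Algebra R E]
  [IsFractionRing R E] [IsDomain R] [IsDiscreteValuationRing R] [Finite (IsLocalRing.ResidueField R)]
  (hstar : ∀ x : E, IsLocalization.IsInteger R x → IsLocalization.IsInteger R (star x))
  (u : E) (hsu : star u = u) (hu0 : u ≠ 0) (hu : IsLocalization.IsInteger R u)
  (hu' : IsLocalization.IsInteger R u⁻¹) {ϖ : R} (hϖ : Irreducible ϖ)
  (hs : star (algebraMap R E ϖ) = algebraMap R E ϖ) (k : Type*) [Field k]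
  {C : Type*} [Semiring C] [Algebra k C]

/-- **The Hecke eigencharacter is one parameter**: two characters of `H(U(J₃(u)), K_U)` agreeing
on the first cell operator `T₁` agree everywhere (given the leading-term property of the cell
basis). -/
theorem heckeAlgebra_algHom_ext_of_leading
    (hlead : ∀ n, T5HeckeBasisCells.heckeBasisCells hstar u hsu hu0 hu hu' hϖ hs k 1 *
        T5HeckeBasisCells.heckeBasisCells hstar u hsu hu0 hu hu' hϖ hs k n -
        T5HeckeBasisCells.heckeBasisCells hstar u hsu hu0 hu hu' hϖ hs k (n + 1) ∈
      span k (⇑(T5HeckeBasisCells.heckeBasisCells hstar u hsu hu0 hu hu' hϖ hs k) '' {i | i < n + 1}))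
    {χ χ' : T5HeckePermutationModule.heckeAlgebra k
      (T5UnitaryHeckeAdjoint.hyperspecialSubgroup R (T5HermitianThreeElements.J3 u)) →ₐ[k] C}
    (h : χ (T5HeckeBasisCells.heckeBasisCells hstar u hsu hu0 hu hu' hϖ hs k 1) =
      χ' (T5HeckeBasisCells.heckeBasisCells hstar u hsu hu0 hu hu' hϖ hs k 1)) : χ = χ' :=
  algHom_ext_of_leading (T5HeckeBasisCells.heckeBasisCells hstar u hsu hu0 hu hu' hϖ hs k)
    (T5HeckePolynomialAlgebra.heckeBasisCells_zero hstar u hsu hu0 hu hu' hϖ hs k) hlead h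

/-- Every `c : C` is the `T₁`-eigenvalue of some character of `H(U(J₃(u)), K_U)` (given the
leading-term property): the Satake parameter ranges freely. -/
theorem heckeAlgebra_exists_algHom_apply_eq
    (hlead : ∀ n, T5HeckeBasisCells.heckeBasisCells hstar u hsu hu0 hu hu' hϖ hs k 1 *
        T5HeckeBasisCells.heckeBasisCells hstar u hsu hu0 hu hu' hϖ hs k n -
        T5HeckeBasisCells.heckeBasisCells hstar u hsu hu0 hu hu' hϖ hs k (n + 1) ∈
      span k (⇑(T5HeckeBasisCells.heckeBasisCells hstar u hsu hu0 hu hu' hϖ hs k) '' {i | i < n + 1}))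
    (c : C) :
    ∃ χ : T5HeckePermutationModule.heckeAlgebra k
      (T5UnitaryHeckeAdjoint.hyperspecialSubgroup R (T5HermitianThreeElements.J3 u)) →ₐ[k] C,
      χ (T5HeckeBasisCells.heckeBasisCells hstar u hsu hu0 hu hu' hϖ hs k 1) = c :=
  exists_algHom_apply_eq (T5HeckeBasisCells.heckeBasisCells hstar u hsu hu0 hu hu' hϖ hs k)
    (T5HeckePolynomialAlgebra.heckeBasisCells_zero hstar u hsu hu0 hu hu' hϖ hs k) hlead c

end Hecke

end Summit.Ventures.HodgeRepro2.T5HeckeCharacterParameter
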